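import Literature.NumberTheory.Automorphic.BianchiCuspIdealClasses
import Mathlib.Topology.MetricSpace.ProperSpace
import Mathlib.Topology.Order.Compact
import HarnessLib

/-!
# Local finiteness for the cover of the Hermitian cone by translates of boxes and cusp boxes

Topic `NumberTheory/Automorphic`; namespace `Literature.NumberTheory.Automorphic`, grouping
sub-namespace `BianchiCusp`.  Theorems only; sequel of `BianchiCuspIdealClasses`.

Two finiteness statements about `Γ = GL₂(𝓞_K)` (`K` imaginary quadratic) acting on the cone `𝒫`
that make the cover by translates of finitely many thick boxes and cusp boxes LOCALLY FINITE ([ElstrodtGrunewaldMennicke1998, Ch. 2 §2.2–2.3 (properly discontinuous action, locally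
finite fundamental domains), Ch. 7 §7.3]; [BorelSerre1973, §11]):

* `finite_gamma_meeting` (**properness**) — for compact `C, C' ⊆ 𝒫` only finitely many `γ` have
  `t · (γ • H) ∈ C'` for some `H ∈ C`, `t > 0` (the entries of `σ(γ⁻¹)` are bounded by
  coercivity, `BianchiConeHoroballs.qf_ge_coer`, and `σ(𝓞_K)` is discrete);
* `exists_finite_lines` — for compact `C ⊆ 𝒫` the cusps of depth `< 1` somewhere on `C` lie on
  finitely many lines (the depth bound and the finiteness of cusp classes up to scalars);
  with `depth_act_eq` this feeds `finite_gamma_cusp` of `BianchiCuspStabilizerFinite`.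

## References

* J. Elstrodt, F. Grunewald, J. Mennicke, *Groups Acting on Hyperbolic Space* (1998), Ch. 2
  §2.2–2.3, Ch. 7 §7.3 [ElstrodtGrunewaldMennicke1998].
* A. Borel, J.-P. Serre, Comment. Math. Helv. 48 (1973), §11 [BorelSerre1973].
-/

noncomputable section

open Matrix Complex NumberField
open scoped MatrixGroups ComplexConjugate

namespace Literature.NumberTheory.Automorphic

namespace BianchiCusp

open BianchiCone Literature.NumberTheory.NumberFields

variable {K : Type*} [Field K] [NumberField K] (σ : K →+* ℂ)

/-! ### Auxiliary facts -/

/-- `H[e_k] = H_kk`. [folklore] -/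
theorem qf_single (H : Mat) (k : Fin 2) : qf H (Pi.single k 1) = (H k k).re := by
  fin_cases k <;> simp [qf, dotProduct, mulVec, Fin.sum_univ_two]

/-- A column of a matrix as `M e_k`. [folklore] -/
theorem mulVec_single_apply (X : Mat) (k i : Fin 2) : (X *ᵥ Pi.single k 1) i = X i k := by
  fin_cases k <;> fin_cases i <;> simp [mulVec, dotProduct, Fin.sum_univ_two]

/-- A continuous real function attains a minimum on a non-empty compact set. [folklore] -/
theorem exists_forall_le_of_isCompact {C : Set Mat} (hC : IsCompact C) (hne : C.Nonempty) {f : Mat → ℝ}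
    (hf : Continuous f) : ∃ H₀ ∈ C, ∀ H ∈ C, f H₀ ≤ f H :=
  hC.exists_isMinOn hne hf.continuousOn

/-- A continuous real function attains a maximum on a non-empty compact set. [folklore] -/
theorem exists_forall_ge_of_isCompact {C : Set Mat} (hC : IsCompact C) (hne : C.Nonempty) {f : Mat → ℝ}
    (hf : Continuous f) : ∃ H₀ ∈ C, ∀ H ∈ C, f H ≤ f H₀ :=
  hC.exists_isMaxOn hne hf.continuousOn

/-- Matrices over `𝓞_K` with `σ`-bounded entries are finite in number. [folklore] -/
theorem finite_matrix_norm_le [IsTotallyComplex K] (hK : Module.finrank ℚ K = 2) (B : ℝ) :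
    {M : Matrix (Fin 2) (Fin 2) (𝓞 K) | ∀ i j, ‖σ (M i j : K)‖ ≤ B}.Finite := by
  have h : {M : Matrix (Fin 2) (Fin 2) (𝓞 K) | ∀ i j, ‖σ (M i j : K)‖ ≤ B} ⊆
      Set.pi Set.univ fun _ => Set.pi Set.univ fun _ => {x : 𝓞 K | ‖σ (x : K)‖ ≤ B} := by
    intro M hM i _ j _
    exact hM i j
  exact Set.Finite.subset (Set.Finite.pi fun _ => Set.Finite.pi fun _ =>
    ImaginaryQuadratic.finite_setOf_norm_le hK σ B) h

/-! ### Properness -/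

/-- **Properness of the action up to scalars**: for compact `C, C' ⊆ 𝒫` only finitely many
`γ ∈ GL₂(𝓞_K)` satisfy `t · (γ • H) ∈ C'` for some `H ∈ C` and `t > 0`.
[cite: ElstrodtGrunewaldMennicke1998, Ch. 2 §2.2] -/
theorem finite_gamma_meeting [IsTotallyComplex K] (hK : Module.finrank ℚ K = 2) {C C' : Set Mat}
    (hC : IsCompact C) (hC' : IsCompact C') (hCc : C ⊆ cone) (hC'c : C' ⊆ cone) :
    {γ : GL (Fin 2) (𝓞 K) | ∃ H ∈ C, ∃ t : ℝ, 0 < t ∧ t • act (toGL σ γ) H ∈ C'}.Finite := by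
  rcases C.eq_empty_or_nonempty with rfl | hne
  · simp
  rcases C'.eq_empty_or_nonempty with rfl | hne'
  · simp
  -- bounds on the compact sets
  obtain ⟨Hc, hHc, hcoer⟩ := exists_forall_le_of_isCompact hC hne continuous_coer
  obtain ⟨Hd, hHd, hdmax⟩ := exists_forall_ge_of_isCompact hC hne continuous_hdet
  obtain ⟨Hd', hHd', hdmin'⟩ := exists_forall_le_of_isCompact hC' hne' continuous_hdet
  obtain ⟨He, hHe, hdiag⟩ := exists_forall_ge_of_isCompact hC' hne'
    (f := fun M : Mat => (M 0 0).re + (M 1 1).re)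
    ((Complex.continuous_re.comp ((continuous_apply 0).comp (continuous_apply 0))).add
      (Complex.continuous_re.comp ((continuous_apply 1).comp (continuous_apply 1))))
  set c₀ := coer Hc with hc₀
  set d₁ := hdet Hd with hd₁
  set d₀ := hdet Hd' with hd₀
  set E := (He 0 0).re + (He 1 1).re with hE
  have hc₀p : 0 < c₀ := coer_pos (hCc hHc)
  have hd₁p : 0 < d₁ := (hCc hHd).2.2
  have hd₀p : 0 < d₀ := (hC'c hHd').2.2
  set t₀ : ℝ := Real.sqrt (d₀ / d₁) with ht₀
  have ht₀p : 0 < t₀ := Real.sqrt_pos.2 (div_pos hd₀p hd₁p)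
  set B : ℝ := Real.sqrt (E / (t₀ * c₀)) with hB
  -- the set is contained in the preimage of a finite set of matrices under `γ ↦ γ⁻¹`
  have hsub : {γ : GL (Fin 2) (𝓞 K) | ∃ H ∈ C, ∃ t : ℝ, 0 < t ∧ t • act (toGL σ γ) H ∈ C'} ⊆
      (fun γ : GL (Fin 2) (𝓞 K) => ((γ⁻¹ : GL (Fin 2) (𝓞 K)) : Matrix (Fin 2) (Fin 2) (𝓞 K))) ⁻¹'
        {M : Matrix (Fin 2) (Fin 2) (𝓞 K) | ∀ i j, ‖σ (M i j : K)‖ ≤ B} := by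
    rintro γ ⟨H, hH, t, ht, hmem⟩ i k
    have hHc' := hCc hH
    have hmc := hC'c hmem
    -- `t ≥ t₀`
    have hdetγ : hdet (act (toGL σ γ) H) = hdet H := by
      rw [hdet_act _ hHc'.1, Complex.normSq_eq_norm_sq, norm_det_toGL σ hK, one_pow, div_one]
    have ht2 : d₀ / d₁ ≤ t ^ 2 := by
      have h1 : d₀ ≤ hdet (t • act (toGL σ γ) H) := hdmin' _ hmem
      rw [hdet_smul, hdetγ] at h1
      have h2 : hdet H ≤ d₁ := hdmax _ hH
      rw [div_le_iff₀ hd₁p]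
      nlinarith [hHc'.2.2]
    have htge : t₀ ≤ t := by
      rw [ht₀, ← Real.sqrt_sq ht.le]; exact Real.sqrt_le_sqrt ht2
    -- the `k`-th column of `X = σ(γ⁻¹)`
    set X : Mat := (((toGL σ γ)⁻¹ : GL (Fin 2) ℂ) : Mat) with hX
    have hq1 : qf (act (toGL σ γ) H) (Pi.single k 1) = qf H (X *ᵥ Pi.single k 1) := qf_act _ _ _
    have hq2 : coer H * (Complex.normSq ((X *ᵥ Pi.single k 1) 0) + Complex.normSq ((X *ᵥ Pi.single k 1) 1)) ≤
        qf H (X *ᵥ Pi.single k 1) := qf_ge_coer hHc' _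
    have hq3 : t * qf (act (toGL σ γ) H) (Pi.single k 1) ≤ E := by
      rw [← qf_smul t, qf_single]
      have := hdiag _ hmem
      have h0 := hmc.2.1
      have h1 := apply_one_one_pos hmc
      fin_cases k
      · change ((t • act (toGL σ γ) H) 0 0).re ≤ E; linarith
      · change ((t • act (toGL σ γ) H) 1 1).re ≤ E; linarith
    have hS : Complex.normSq (X i k) ≤ E / (t₀ * c₀) := by
      rw [mulVec_single_apply, mulVec_single_apply] at hq2
      have hcH : c₀ ≤ coer H := hcoer _ hH
      have hsum : Complex.normSq (X i k) ≤ Complex.normSq (X 0 k) + Complex.normSq (X 1 k) := by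
        fin_cases i
        · exact le_add_of_nonneg_right (Complex.normSq_nonneg _)
        · exact le_add_of_nonneg_left (Complex.normSq_nonneg _)
      have hS0 : 0 ≤ Complex.normSq (X 0 k) + Complex.normSq (X 1 k) :=
        add_nonneg (Complex.normSq_nonneg _) (Complex.normSq_nonneg _)
      rw [le_div_iff₀ (mul_pos ht₀p hc₀p)]
      calc Complex.normSq (X i k) * (t₀ * c₀) ≤ (Complex.normSq (X 0 k) + Complex.normSq (X 1 k)) * (t * coer H) := by
            apply mul_le_mul hsum (mul_le_mul htge hcH hc₀p.le ht.le) (mul_nonneg ht₀p.le hc₀p.le) hS0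
        _ = t * (coer H * (Complex.normSq (X 0 k) + Complex.normSq (X 1 k))) := by ring
        _ ≤ t * qf H (X *ᵥ Pi.single k 1) := mul_le_mul_of_nonneg_left hq2 ht.le
        _ = t * qf (act (toGL σ γ) H) (Pi.single k 1) := by rw [hq1]
        _ ≤ E := hq3
    have hXe : X i k = σ (((γ⁻¹ : GL (Fin 2) (𝓞 K)) : Matrix (Fin 2) (Fin 2) (𝓞 K)) i k : K) := by
      rw [hX, ← map_inv, toGL_apply]
    change ‖σ ((((γ⁻¹ : GL (Fin 2) (𝓞 K)) : Matrix (Fin 2) (Fin 2) (𝓞 K)) i k : 𝓞 K) : K)‖ ≤ B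
    rw [← hXe, hB, ← Real.sqrt_sq (norm_nonneg _), ← Complex.normSq_eq_norm_sq]
    exact Real.sqrt_le_sqrt hS
  refine Set.Finite.subset (Set.Finite.preimage ?_ (finite_matrix_norm_le σ hK B)) hsub
  intro γ _ γ' _ h
  exact inv_injective (Units.ext h)

/-! ### Cusps shallow on a compact set lie on finitely many lines -/

/-- The depth bound with the coercivity constant and the ideal norm. [folklore] -/
theorem depth_ge_of_coer {v : OVec K} (hv : v ≠ 0) {H : Mat} (hH : H ∈ cone) :
    coer H * (Complex.normSq (σ (v 0 : K)) + Complex.normSq (σ (v 1 : K))) /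
      ((Ideal.absNorm (idealOf v) : ℝ) * rdet H) ≤ depth σ v H := by
  unfold depth
  have hN : (0 : ℝ) < Ideal.absNorm (idealOf v) := by exact_mod_cast absNorm_idealOf_pos hv
  refine div_le_div_of_nonneg_right ?_ (mul_pos hN (rdet_pos hH)).le
  exact qf_ge_coer hH (emb σ v)

/-- **Cusps of depth `< 1` somewhere on a compact set lie on finitely many lines.**
[cite: ElstrodtGrunewaldMennicke1998, Ch. 7 §7.3] -/
theorem exists_finite_lines [IsTotallyComplex K] (hK : Module.finrank ℚ K = 2) {C : Set Mat}
    (hC : IsCompact C) (hCc : C ⊆ cone) :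
    ∃ F : Set (OVec K), F.Finite ∧ (∀ f ∈ F, f ≠ 0) ∧ ∀ w : OVec K, w ≠ 0 →
      (∃ M ∈ C, depth σ w M < 1) → ∃ f ∈ F, w 0 * f 1 - w 1 * f 0 = 0 := by
  classical
  rcases C.eq_empty_or_nonempty with rfl | hne
  · exact ⟨∅, Set.finite_empty, by simp, fun w _ ⟨M, hM, _⟩ => absurd hM (Set.notMem_empty M)⟩
  obtain ⟨Hc, hHc, hcoer⟩ := exists_forall_le_of_isCompact hC hne continuous_coer
  obtain ⟨Hr, hHr, hrmax⟩ := exists_forall_ge_of_isCompact hC hne continuous_rdet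
  set c₀ := coer Hc with hc₀
  set r₁ := rdet Hr with hr₁
  have hc₀p : 0 < c₀ := coer_pos (hCc hHc)
  have hr₁p : 0 < r₁ := rdet_pos (hCc hHr)
  obtain ⟨S, hS0, hS⟩ := exists_scaled_eq_of_classes (K := K)
  set Nmax : ℝ := ∑ u ∈ S, (Ideal.absNorm (idealOf u) : ℝ) with hNmax
  have hNle : ∀ u ∈ S, (Ideal.absNorm (idealOf u) : ℝ) ≤ Nmax := fun u hu =>
    Finset.single_le_sum (f := fun v => (Ideal.absNorm (idealOf v) : ℝ)) (fun v _ => Nat.cast_nonneg _) hu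
  set B2 : ℝ := Nmax * r₁ / c₀ with hB2
  let F : Set (OVec K) := {f | f ≠ 0 ∧ ∀ i, Complex.normSq (σ (f i : K)) ≤ B2}
  have hFfin : F.Finite := by
    refine Set.Finite.subset (Set.Finite.pi fun _ => ImaginaryQuadratic.finite_setOf_norm_le hK σ (Real.sqrt B2)) ?_
    rintro f ⟨-, hf⟩ i -
    change ‖σ (f i : K)‖ ≤ Real.sqrt B2
    rw [← Real.sqrt_sq (norm_nonneg _), ← Complex.normSq_eq_norm_sq]
    exact Real.sqrt_le_sqrt (hf i)
  refine ⟨F, hFfin, fun f hf => hf.1, fun w hw ⟨M, hM, hdep⟩ => ?_⟩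
  obtain ⟨u, huS, w'', x, y, hx, hy, hxy, hideal⟩ := hS w hw
  have hMc := hCc hM
  -- `depth w'' M = depth w M`
  have hdep'' : depth σ w'' M = depth σ w M := by
    rw [← depth_cmul σ hK hy w'' M, ← hxy, depth_cmul σ hK hx]
  have hw'' : w'' ≠ 0 := by
    intro h0
    rw [h0, smul_zero] at hxy
    apply hw
    funext i
    have := congrFun hxy i
    simp only [Pi.smul_apply, smul_eq_mul, Pi.zero_apply, mul_eq_zero] at this
    exact this.resolve_left hx
  refine ⟨w'', ⟨hw'', fun i => ?_⟩, ?_⟩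
  · -- the bound
    have hb := depth_ge_of_coer σ hw'' hMc
    rw [hdep''] at hb
    have hlt := lt_of_le_of_lt hb hdep
    have hN : (0 : ℝ) < Ideal.absNorm (idealOf w'') := by exact_mod_cast absNorm_idealOf_pos hw''
    rw [div_lt_one (mul_pos hN (rdet_pos hMc))] at hlt
    have hcM : c₀ ≤ coer M := hcoer _ hM
    have hrM : rdet M ≤ r₁ := hrmax _ hM
    have hNw : (Ideal.absNorm (idealOf w'') : ℝ) ≤ Nmax := by rw [hideal]; exact hNle u huS
    have hsum : Complex.normSq (σ (w'' i : K)) ≤ Complex.normSq (σ (w'' 0 : K)) + Complex.normSq (σ (w'' 1 : K)) := by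
      fin_cases i
      · exact le_add_of_nonneg_right (Complex.normSq_nonneg _)
      · exact le_add_of_nonneg_left (Complex.normSq_nonneg _)
    have hS0 : 0 ≤ Complex.normSq (σ (w'' 0 : K)) + Complex.normSq (σ (w'' 1 : K)) :=
      add_nonneg (Complex.normSq_nonneg _) (Complex.normSq_nonneg _)
    rw [hB2, le_div_iff₀ hc₀p]
    calc Complex.normSq (σ (w'' i : K)) * c₀
        ≤ (Complex.normSq (σ (w'' 0 : K)) + Complex.normSq (σ (w'' 1 : K))) * coer M :=
          mul_le_mul hsum hcM hc₀p.le hS0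
      _ = coer M * (Complex.normSq (σ (w'' 0 : K)) + Complex.normSq (σ (w'' 1 : K))) := mul_comm _ _
      _ ≤ (Ideal.absNorm (idealOf w'') : ℝ) * rdet M := hlt.le
      _ ≤ Nmax * r₁ := mul_le_mul hNw hrM (rdet_nonneg _) (Finset.sum_nonneg fun _ _ => Nat.cast_nonneg _)
  · -- parallel
    have h0 := congrFun hxy 0
    have h1 := congrFun hxy 1
    simp only [Pi.smul_apply, smul_eq_mul] at h0 h1
    have : x * (w 0 * w'' 1 - w 1 * w'' 0) = 0 := by
      linear_combination w'' 1 * h0 - w'' 0 * h1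
    exact (mul_eq_zero.1 this).resolve_left hx

/-! ### Finitely many group elements move a compact set into a cusp box -/

omit [NumberField K] in
/-- The `2 × 2` determinant of transformed vectors. [folklore] -/
theorem det2o_mulVec (M : Matrix (Fin 2) (Fin 2) (𝓞 K)) (a b : OVec K) :
    (M *ᵥ a) 0 * (M *ᵥ b) 1 - (M *ᵥ a) 1 * (M *ᵥ b) 0 = M.det * (a 0 * b 1 - a 1 * b 0) := by
  simp [mulVec, dotProduct, Fin.sum_univ_two, det_fin_two]
  ring

omit [NumberField K] in
/-- Vectors parallel to the same non-zero vector are parallel. [folklore] -/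
theorem det2o_trans {a b f : OVec K} (hf : f ≠ 0) (ha : a 0 * f 1 - a 1 * f 0 = 0)
    (hb : b 0 * f 1 - b 1 * f 0 = 0) : a 0 * b 1 - a 1 * b 0 = 0 := by
  by_cases h0 : f 0 = 0
  · have h1 : f 1 ≠ 0 := by
      intro h1; apply hf; funext i; fin_cases i; exact h0; exact h1
    rw [h0, mul_zero, sub_zero] at ha hb
    have ha' := (mul_eq_zero.1 ha).resolve_right h1
    have hb' := (mul_eq_zero.1 hb).resolve_right h1
    rw [ha', hb']; ring
  · have : f 0 * (a 0 * b 1 - a 1 * b 0) = 0 := by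
      linear_combination b 0 * ha - a 0 * hb
    exact (mul_eq_zero.1 this).resolve_left h0

/-- `depth_u (γ • H) = depth_{γ⁻¹ u} H`. [folklore] -/
theorem depth_act_eq [IsTotallyComplex K] (hK : Module.finrank ℚ K = 2) (γ : GL (Fin 2) (𝓞 K))
    (v : OVec K) {H : Mat} (hH : H.IsHermitian) :
    depth σ v (act (toGL σ γ) H) = depth σ (((γ⁻¹ : GL (Fin 2) (𝓞 K)) : Matrix (Fin 2) (Fin 2) (𝓞 K)) *ᵥ v) H := by
  have h := depth_act_inv σ hK γ⁻¹ v hH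
  rwa [map_inv, inv_inv] at h

end BianchiCusp

end Literature.NumberTheory.Automorphic
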